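import Mathlib.LinearAlgebra.Matrix.Charpoly.Basic
import Literature.MathematicalPhysics.QuantumLattice.KohnLuttinger

/-!
# Exact bilayer (even/odd = bonding/antibonding) splitting identities

Two pieces of EXACT algebra behind the "bilayer cuprate ↦ one band per plane + inter-plane
hopping `t⊥(k)`" bookkeeping of the downfolding literature (YBa₂Cu₃O₇, Bi-2212, Hg-1212, …).
Everything is a proved theorem; there are no named facts.  The physics (which orbitals carry the
inter-plane hopping, the size of `t⊥`) lives in the cited sources, not here.

## 1. Even/odd block-diagonalisation of a symmetric bilayer

A bilayer of two IDENTICAL planes with one-particle Hamiltonian block `H` on each plane and a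
layer-SYMMETRIC inter-plane block `T` is the block matrix `fromBlocks H T T H`.  The even/odd
(bonding/antibonding) combiner `P = fromBlocks 1 1 1 (-1)` satisfies `P * P = 2 • 1` and
`P * fromBlocks H T T H * P = 2 • fromBlocks (H + T) 0 0 (H - T)` over ANY ring
(`evenOddCombiner_mul_bilayer_mul_evenOddCombiner`) — the matrix form of Andersen–Liechtenstein–
Jepsen–Paulsen's statement that the even and odd plane bands of YBa₂Cu₃O₇ are governed by
`H⁺ = H + (inter-plane terms)` and `H⁻ = H − (inter-plane terms)` with `t⊥(k) ≡ ½[ε⁻(k) − ε⁺(k)]`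
[AndersenEtAl1995, §8 Eq. (23) and the definition of `t⊥_ij` before it].  Consequences proved here:
every even (resp. odd) eigenvector of `H + T` (resp. `H − T`) gives a bilayer eigenvector
(`bilayer_mulVec_even`, `bilayer_mulVec_odd`), and — when `2` is invertible — the characteristic
polynomial FACTORISES, `charpoly (fromBlocks H T T H) = charpoly (H + T) * charpoly (H − T)`
(`charpoly_bilayer`), i.e. the bilayer spectrum is exactly the union of the bonding and
antibonding spectra.  No commutation hypothesis on `H`, `T` is needed.

## 2. The `(cos kx − cos ky)²` inter-plane form, absorbed into per-band one-band parameters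

Chakravarty–Sudbø–Anderson–Strong's inter-plane hopping `t⊥(k) = (t⊥/4)(cos kx a − cos ky a)²`
[ChakravartyEtAl1993] (derived from LDA as `t⊥(k) ≈ 0.25 eV · v²`, `v = ½(cos ky − cos kx)`, at
leading order in `u`, by [AndersenEtAl1995, abstract and §8 Eq. (24)]) is a trigonometric
polynomial: `(t⊥/4)(cos x − cos y)² = t⊥/4 + (t⊥/8)(cos 2x + cos 2y) − (t⊥/2) cos x cos y`
(`chakravartyForm_eq`).  Hence adding `± t⊥(k)` to the `t–t′–t″` square-lattice band
`ε(k) = −2t(cos kx + cos ky) − 4t′ cos kx cos ky − 2t″(cos 2kx + cos 2ky)` (the tree's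
`squareDispersion t t'` plus the third-neighbour term) gives AGAIN a `t–t′–t″` band with the SAME
`t`, shifted `t′ ↦ t′ + s t⊥/8`, `t″ ↦ t″ − s t⊥/16` and a constant `s t⊥/4` (`s = +1` antibonding,
`s = −1` bonding): `squareDispersion₃_add_chakravartyForm`.  This is the exact statement behind
"fitting the bonding and antibonding bands separately moves `t′` and `t″` but not `t`"; the
whole-band one-band tables of [AndersenEtAl1995, §7] for YBa₂Cu₃O₇ (odd `t′ = 96`, `t″ = 62` meV
vs even `113`, `110` meV at `t = 349 / 422` meV) show the direction of these shifts plus the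
further `u`-dependence `(1 − 2u t′/t)⁻²` and non-`Cu s` channels that this pure-`v²` identity does
not model.

Not here: anything approximate (the LDA values of `t⊥`, the `(1 − 2u t′/t)⁻²` factor, trilayers,
inequivalent planes `fromBlocks H₁ T Tᴴ H₂`), and no spectral ordering statements.

References: O. K. Andersen, A. I. Liechtenstein, O. Jepsen, F. Paulsen, *LDA energy bands,
low-energy Hamiltonians, t′, t″, t⊥(k), and J⊥*, J. Phys. Chem. Solids 56 (1995) 1573,
arXiv:cond-mat/9509044, §7–§8 · S. Chakravarty, A. Sudbø, P. W. Anderson, S. Strong, *Interlayer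
tunneling and gap anisotropy in high-temperature superconductors*, Science 261 (1993) 337.
AI-produced formalisation (H21, cell hubbard-downfold, seat lit-2, 2026-08-26); no facts, no axioms
beyond Mathlib's, no `sorry`.
-/

namespace Literature.MathematicalPhysics.QuantumLattice

open Matrix

/-! ## 1. Even/odd block-diagonalisation -/

section EvenOdd

variable {n : Type*} [DecidableEq n] {R : Type*} [CommRing R]

/-- The even/odd (bonding/antibonding) combiner of a bilayer, `P = fromBlocks 1 1 1 (-1)`:
`P (x ⊕ y) = (x + y) ⊕ (x − y)` (unnormalised; `P * P = 2 • 1`).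
[cite: AndersenEtAl1995, §8 Eq. (23)] -/
def evenOddCombiner : Matrix (n ⊕ n) (n ⊕ n) R :=
  fromBlocks 1 1 1 (-1)

/-- Unfolding of the combiner. [cite: AndersenEtAl1995, §8 Eq. (23)] -/
theorem evenOddCombiner_def :
    (evenOddCombiner : Matrix (n ⊕ n) (n ⊕ n) R) = fromBlocks 1 1 1 (-1) := rfl

/-- `P * P = 2 • 1` for the (unnormalised) even/odd combiner — the normalisation behind
`t⊥(k) ≡ ½[ε⁻(k) − ε⁺(k)]`. [cite: AndersenEtAl1995, §8 Eq. (23)] -/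
theorem evenOddCombiner_mul_self [Fintype n] :
    (evenOddCombiner : Matrix (n ⊕ n) (n ⊕ n) R) * evenOddCombiner = (2 : R) • 1 := by
  rw [evenOddCombiner, fromBlocks_multiply, ← fromBlocks_one, fromBlocks_smul, smul_zero, two_smul]
  simp only [Matrix.mul_one, Matrix.mul_neg, neg_neg]
  congr 1 <;> abel

/-- **Even/odd decomposition of a symmetric bilayer** [cite: AndersenEtAl1995, §8 Eq. (23)]:
conjugating the bilayer block matrix `fromBlocks H T T H` (identical planes `H`, layer-symmetric
inter-plane block `T`) by the unnormalised combiner gives `2 •` the block-DIAGONAL matrix with the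
bonding block `H + T` and the antibonding block `H − T`.  Valid over any commutative ring; no
hypothesis relating `H` and `T`. -/
theorem evenOddCombiner_mul_bilayer_mul_evenOddCombiner [Fintype n] (H T : Matrix n n R) :
    evenOddCombiner * fromBlocks H T T H * evenOddCombiner
      = (2 : R) • fromBlocks (H + T) 0 0 (H - T) := by
  rw [evenOddCombiner, fromBlocks_multiply, fromBlocks_multiply, fromBlocks_smul, smul_zero,
    two_smul, two_smul]
  simp only [Matrix.one_mul, Matrix.mul_one, Matrix.neg_mul, Matrix.mul_neg]
  congr 1 <;> abel

omit [DecidableEq n] in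
/-- An EVEN (bonding) eigenvector: if `(H + T) x = ω x` then `x ⊕ x` is an eigenvector of the
bilayer with the same eigenvalue. [cite: AndersenEtAl1995, §8 Eq. (23)] -/
theorem bilayer_mulVec_even [Fintype n] (H T : Matrix n n R) (x : n → R) (ω : R)
    (hx : (H + T) *ᵥ x = ω • x) :
    fromBlocks H T T H *ᵥ Sum.elim x x = ω • Sum.elim x x := by
  rw [Matrix.add_mulVec] at hx
  rw [fromBlocks_mulVec, Sum.elim_comp_inl, Sum.elim_comp_inr]
  funext i
  rcases i with j | j
  · simpa only [Sum.elim_inl, Pi.smul_apply, Pi.add_apply] using congrFun hx j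
  · simpa only [Sum.elim_inr, Pi.smul_apply, Pi.add_apply, add_comm] using congrFun hx j

omit [DecidableEq n] in
/-- An ODD (antibonding) eigenvector: if `(H − T) x = ω x` then `x ⊕ (−x)` is an eigenvector of
the bilayer with the same eigenvalue. [cite: AndersenEtAl1995, §8 Eq. (23)] -/
theorem bilayer_mulVec_odd [Fintype n] (H T : Matrix n n R) (x : n → R) (ω : R)
    (hx : (H - T) *ᵥ x = ω • x) :
    fromBlocks H T T H *ᵥ Sum.elim x (-x) = ω • Sum.elim x (-x) := by
  rw [Matrix.sub_mulVec] at hx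
  rw [fromBlocks_mulVec, Sum.elim_comp_inl, Sum.elim_comp_inr, Matrix.mulVec_neg,
    Matrix.mulVec_neg]
  funext i
  rcases i with j | j
  · have h := congrFun hx j
    simp only [Pi.sub_apply, Pi.smul_apply] at h
    simp only [Sum.elim_inl, Pi.smul_apply, Pi.add_apply, Pi.neg_apply]
    rw [← h]
    ring
  · have h := congrFun hx j
    simp only [Pi.sub_apply, Pi.smul_apply] at h
    simp only [Sum.elim_inr, Pi.smul_apply, Pi.add_apply, Pi.neg_apply, smul_eq_mul]
    rw [smul_eq_mul] at h
    rw [mul_neg, ← h]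
    ring

/-- The normalised inverse of the combiner when `2` is invertible: `P * (⅟2 • P) = 1`.
[cite: AndersenEtAl1995, §8 Eq. (23)] -/
theorem evenOddCombiner_mul_invOf_two_smul [Fintype n] [Invertible (2 : R)] :
    (evenOddCombiner : Matrix (n ⊕ n) (n ⊕ n) R) * ((⅟ (2 : R)) • evenOddCombiner) = 1 := by
  rw [Matrix.mul_smul, evenOddCombiner_mul_self, smul_smul, invOf_mul_self, one_smul]

/-- `(⅟2 • P) * P = 1`. [cite: AndersenEtAl1995, §8 Eq. (23)] -/
theorem invOf_two_smul_evenOddCombiner_mul [Fintype n] [Invertible (2 : R)] :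
    ((⅟ (2 : R)) • evenOddCombiner) * (evenOddCombiner : Matrix (n ⊕ n) (n ⊕ n) R) = 1 := by
  rw [Matrix.smul_mul, evenOddCombiner_mul_self, smul_smul, invOf_mul_self, one_smul]

/-- The even/odd combiner as a unit of the matrix ring (inverse `⅟2 • P`), when `2` is
invertible (the normalised even/odd change of basis). [cite: AndersenEtAl1995, §8 Eq. (23)] -/
def evenOddCombinerUnit [Fintype n] [Invertible (2 : R)] : (Matrix (n ⊕ n) (n ⊕ n) R)ˣ where
  val := evenOddCombiner
  inv := (⅟ (2 : R)) • evenOddCombiner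
  val_inv := evenOddCombiner_mul_invOf_two_smul
  inv_val := invOf_two_smul_evenOddCombiner_mul

/-- [folklore] -/
private theorem evenOddCombinerUnit_val [Fintype n] [Invertible (2 : R)] :
    ((evenOddCombinerUnit : (Matrix (n ⊕ n) (n ⊕ n) R)ˣ) : Matrix (n ⊕ n) (n ⊕ n) R)
      = evenOddCombiner := rfl

/-- Similarity form of the even/odd decomposition (when `2` is invertible):
`P * fromBlocks H T T H * P⁻¹ = fromBlocks (H + T) 0 0 (H − T)`.
[cite: AndersenEtAl1995, §8 Eq. (23)] -/
theorem evenOddCombiner_conj_bilayer [Fintype n] [Invertible (2 : R)] (H T : Matrix n n R) :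
    (evenOddCombinerUnit : (Matrix (n ⊕ n) (n ⊕ n) R)ˣ).val * fromBlocks H T T H
        * (evenOddCombinerUnit⁻¹ : (Matrix (n ⊕ n) (n ⊕ n) R)ˣ).val
      = fromBlocks (H + T) 0 0 (H - T) := by
  have hinv : (evenOddCombinerUnit⁻¹ : (Matrix (n ⊕ n) (n ⊕ n) R)ˣ).val
      = (⅟ (2 : R)) • (evenOddCombiner : Matrix (n ⊕ n) (n ⊕ n) R) := rfl
  rw [hinv, evenOddCombinerUnit_val, Matrix.mul_smul,
    evenOddCombiner_mul_bilayer_mul_evenOddCombiner, smul_smul, invOf_mul_self, one_smul]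

/-- **Bonding ⊕ antibonding spectrum** [cite: AndersenEtAl1995, §8 Eq. (23)]: for a symmetric
bilayer the characteristic polynomial factorises into those of the bonding block `H + T` and the
antibonding block `H − T` (over any commutative ring in which `2` is invertible; in particular over
`ℝ`/`ℂ` the bilayer eigenvalues with multiplicity are exactly the union of the two families — the
"even and odd plane bands"). -/
theorem charpoly_bilayer [Fintype n] [Invertible (2 : R)] (H T : Matrix n n R) :
    (fromBlocks H T T H).charpoly = (H + T).charpoly * (H - T).charpoly := by
  have hPQ : (evenOddCombiner : Matrix (n ⊕ n) (n ⊕ n) R) * ((⅟ (2 : R)) • evenOddCombiner) = 1 :=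
    evenOddCombiner_mul_invOf_two_smul
  have key : ((⅟ (2 : R)) • (evenOddCombiner : Matrix (n ⊕ n) (n ⊕ n) R))
      * (fromBlocks H T T H * evenOddCombiner) = fromBlocks (H + T) 0 0 (H - T) := by
    rw [Matrix.smul_mul, ← Matrix.mul_assoc, evenOddCombiner_mul_bilayer_mul_evenOddCombiner,
      smul_smul, invOf_mul_self, one_smul]
  calc (fromBlocks H T T H).charpoly
      = (fromBlocks H T T H * ((evenOddCombiner : Matrix (n ⊕ n) (n ⊕ n) R)
          * ((⅟ (2 : R)) • evenOddCombiner))).charpoly := by rw [hPQ, Matrix.mul_one]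
    _ = ((fromBlocks H T T H * evenOddCombiner)
          * ((⅟ (2 : R)) • (evenOddCombiner : Matrix (n ⊕ n) (n ⊕ n) R))).charpoly := by
        rw [Matrix.mul_assoc]
    _ = (((⅟ (2 : R)) • (evenOddCombiner : Matrix (n ⊕ n) (n ⊕ n) R))
          * (fromBlocks H T T H * evenOddCombiner)).charpoly := Matrix.charpoly_mul_comm _ _
    _ = (fromBlocks (H + T) 0 0 (H - T)).charpoly := by rw [key]
    _ = (H + T).charpoly * (H - T).charpoly := Matrix.charpoly_fromBlocks_zero₁₂ (H + T) 0 (H - T)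

end EvenOdd

/-! ## 2. The `(cos kx − cos ky)²` inter-plane form inside the `t–t′–t″` band -/

section Chakravarty

open Real

/-- Chakravarty–Sudbø–Anderson–Strong inter-plane (intra-bilayer) hopping form
`t⊥(k) = (t⊥/4)(cos k₀ − cos k₁)²` on the square-lattice Brillouin zone; it vanishes on the zone
diagonals and is maximal (`= t⊥`) at `X = (π, 0)`. [cite: ChakravartyEtAl1993, Eq. for t⊥(k)] -/
noncomputable def chakravartyForm (tperp : ℝ) (k : Momentum) : ℝ :=
  tperp / 4 * (cos (k 0) - cos (k 1)) ^ 2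

/-- Unfolding. [cite: ChakravartyEtAl1993, Eq. for t⊥(k)] -/
theorem chakravartyForm_def (tperp : ℝ) (k : Momentum) :
    chakravartyForm tperp k = tperp / 4 * (cos (k 0) - cos (k 1)) ^ 2 := rfl

/-- The `t–t′–t″` square-lattice band: the tree's `squareDispersion t t'` (nearest and
next-nearest neighbours, `−2t(cos+cos) − 4t′ cos cos`) plus the third-neighbour term
`−2t″(cos 2k₀ + cos 2k₁)` — the one-band form whose inclusion [AndersenEtAl1995] insists on
("the 1-band Hamiltonian should include 3rd-nearest-neighbor hoppings").
[cite: AndersenEtAl1995, §7 Eq. (16)] -/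
noncomputable def squareDispersion₃ (t t' t'' : ℝ) (k : Momentum) : ℝ :=
  squareDispersion t t' k - 2 * t'' * (cos (2 * k 0) + cos (2 * k 1))

/-- Unfolding (all three harmonics written out). [cite: AndersenEtAl1995, §7 Eq. (16)] -/
theorem squareDispersion₃_def (t t' t'' : ℝ) (k : Momentum) :
    squareDispersion₃ t t' t'' k
      = -2 * t * (cos (k 0) + cos (k 1)) - 4 * t' * cos (k 0) * cos (k 1)
        - 2 * t'' * (cos (2 * k 0) + cos (2 * k 1)) := rfl

/-- With `t″ = 0` the band is the tree's `t–t′` band `squareDispersion`. [cite: AndersenEtAl1995, §7 Eq. (16)] -/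
theorem squareDispersion₃_zero (t t' : ℝ) (k : Momentum) :
    squareDispersion₃ t t' 0 k = squareDispersion t t' k := by
  simp [squareDispersion₃]

/-- **Harmonic content of the `(cos kx − cos ky)²` form** [cite: ChakravartyEtAl1993, Eq. for t⊥(k)]:
`(t⊥/4)(cos x − cos y)² = t⊥/4 + (t⊥/8)(cos 2x + cos 2y) − (t⊥/2) cos x cos y` — a constant, a
THIRD-neighbour (`cos 2k`) harmonic and a NEXT-nearest (`cos kx cos ky`) harmonic, and NO
nearest-neighbour (`cos kx + cos ky`) harmonic. -/
theorem chakravartyForm_eq (tperp : ℝ) (k : Momentum) :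
    chakravartyForm tperp k
      = tperp / 4 + tperp / 8 * (cos (2 * k 0) + cos (2 * k 1))
        - tperp / 2 * cos (k 0) * cos (k 1) := by
  rw [chakravartyForm, Real.cos_two_mul, Real.cos_two_mul]
  ring

/-- **Per-band absorption of the inter-plane form** [cite: AndersenEtAl1995, §7–§8]: adding
`s · t⊥(k)` of the Chakravarty form (`s = 1` antibonding, `s = −1` bonding, any real `s`) to a
`t–t′–t″` band yields again a `t–t′–t″` band with the SAME nearest-neighbour `t`, shifted
`t′ ↦ t′ + s t⊥/8`, `t″ ↦ t″ − s t⊥/16`, plus the constant `s t⊥/4` (sign conventions of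
`squareDispersion`: `−4t′ cos cos`, `−2t″(cos 2 + cos 2)`).  Exact trigonometric identity. -/
theorem squareDispersion₃_add_chakravartyForm (t t' t'' tperp s : ℝ) (k : Momentum) :
    squareDispersion₃ t t' t'' k + s * chakravartyForm tperp k
      = s * tperp / 4
        + squareDispersion₃ t (t' + s * tperp / 8) (t'' - s * tperp / 16) k := by
  rw [chakravartyForm_eq, squareDispersion₃_def, squareDispersion₃_def]
  ring

/-- The bonding/antibonding pair written out: with `ε = squareDispersion₃ t t' t''`,
`ε(k) − t⊥(k)` and `ε(k) + t⊥(k)` are the `t–t′–t″` bands with parameters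
`(t, t′ − t⊥/8, t″ + t⊥/16)` and `(t, t′ + t⊥/8, t″ − t⊥/16)` up to the constants `∓ t⊥/4`; in
particular HALF their difference is `t⊥(k)` [cite: AndersenEtAl1995, §8 Eq. (23)]. -/
theorem squareDispersion₃_bonding_antibonding (t t' t'' tperp : ℝ) (k : Momentum) :
    squareDispersion₃ t t' t'' k - chakravartyForm tperp k
        = -(tperp / 4) + squareDispersion₃ t (t' - tperp / 8) (t'' + tperp / 16) k ∧
      squareDispersion₃ t t' t'' k + chakravartyForm tperp k
        = tperp / 4 + squareDispersion₃ t (t' + tperp / 8) (t'' - tperp / 16) k := by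
  constructor
  · rw [chakravartyForm_eq, squareDispersion₃_def, squareDispersion₃_def]
    ring
  · rw [chakravartyForm_eq, squareDispersion₃_def, squareDispersion₃_def]
    ring

/-- The inter-plane form vanishes on the zone diagonals `cos k₀ = cos k₁` (the even–odd splitting
"almost vanishes along ΓM" in the LDA bands [AndersenEtAl1995, §8]). [cite: ChakravartyEtAl1993, Eq. for t⊥(k)] -/
theorem chakravartyForm_eq_zero_of_cos_eq (tperp : ℝ) (k : Momentum) (h : cos (k 0) = cos (k 1)) :
    chakravartyForm tperp k = 0 := by
  simp [chakravartyForm, h]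

/-- At the saddle point `X = (π, 0)` the inter-plane form takes its full value `t⊥`
(`(cos π − cos 0)² = 4`): the even–odd splitting `2 t⊥(X)` is maximal there
[AndersenEtAl1995, §8: "maximum of 0.6 eV at X" for YBa₂Cu₃O₇]. [cite: ChakravartyEtAl1993, Eq. for t⊥(k)] -/
theorem chakravartyForm_X (tperp : ℝ) (k : Momentum) (h0 : k 0 = Real.pi) (h1 : k 1 = 0) :
    chakravartyForm tperp k = tperp := by
  rw [chakravartyForm, h0, h1, Real.cos_pi, Real.cos_zero]
  ring

end Chakravarty

end Literature.MathematicalPhysics.QuantumLattice
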